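import Literature.Topology.FourManifolds.PreliminaryRearrangement
import Literature.Topology.FourManifolds.FlowsBoundaryTangent
import Literature.Topology.FourManifolds.SPC4MorseExistence
import Literature.Topology.FourManifolds.MorseAffine
import Literature.Topology.FourManifolds.CobordismMorseFunctions
import Literature.Topology.FourManifolds.FlowFibreMorseAlgebra
import Mathlib.Analysis.Calculus.LocalExtr.Basic
import Mathlib.Analysis.Calculus.Deriv.Slope
import Mathlib.Analysis.SpecialFunctions.SmoothTransition
import HarnessLib

/-!
# A Morse function adapted to the boundary from interior Morse data and an inward field

Topic `Literature/Topology/FourManifolds` (the endgame of handle counts produced by Morse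
functions that are only controlled in the interior; fact seat
`provefact-Literature.Geometry.Symplectic.Oba2016_s-add47373d4`, Kas' handle decomposition of
the total space of a Lefschetz fibration over the disc, where the natural Morse function
`A ∘ f + B` is proper on the interior and blows up at the boundary).  Everything is proved; no
definitions, no named facts.

**The gluing** (Milnor, *Lectures on the h-cobordism theorem* (1965), Lemma 2.6 and the proof of
Thm. 2.7 / Lemma 3.7: boundary-defining functions, and functions monotone along a transverse
field are glued by cut-offs without creating critical points).  Let `W` be a compact manifold
with boundary, `G : W → ℝ` smooth at the interior points, `Z` a smooth vector field pointing
strictly inward along `∂W`, and `K ⊆ Int W` compact such that `Z(G) < 0` at the interior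
points off `K` and the critical points of `G` in `K` are nondegenerate.  With Milnor's
boundary-defining function `f₀` (`= 1`, `df₀ ≠ 0` on `∂W`, `< 1` inside;
`exists_contMDiff_eq_one_on_boundary`) one has `Z(f₀) < 0` near `∂W` (`f₀` is maximal on `∂W`
and `Z` is inward: `mlineDeriv_neg_of_forall_le_of_mem_boundary`), hence on a collar
`{f₀ ≥ 1 - 3ε}` missing `K`; the function
`F = χ(f₀) f₀ + (1 - χ(f₀)) κ(G)`, `χ` a monotone cut-off (`0` below `1 - 2ε`, `1` above
`1 - ε`), `κ(s) = 1 - 3ε - e^{-s}`, equals `f₀` near `∂W`, equals `κ ∘ G` on `{f₀ < 1 - 2ε} ⊇ K`,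
and has `Z(F) < 0` in between; so `F` is a Morse function adapted to `∂W` whose critical
points are exactly the critical points of `G` in `K`, with the same indices
(`exists_isMorseAdapted_of_interior`), and `W` has the handle decomposition counted by them
(`hasHandleDecomposition_of_interior`).

* §1 `mhessian_real_comp_of_isMCriticalPt` — at an interior critical point,
  `Hess (φ ∘ f) = φ'(f x) · Hess f`; index and nondegeneracy under `φ' > 0`;
* §2 `mlineDeriv_neg_of_forall_le_of_mem_boundary` — a function maximal and regular at a
  boundary point strictly decreases along inward vectors there;
* §3 `mlineDeriv_cutoffCombination` — `Z(A B + (1 - A) C)`;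
* §4 the gluing theorems.

## References

* J. Milnor, *Lectures on the h-cobordism theorem*, Princeton (1965), Lemma 2.6, Thm. 2.7,
  Def. 3.1, Lemma 3.7. [MilnorHCobordism1965]
* J. Milnor, *Morse theory*, Ann. of Math. Studies 51 (1963), §§2–3. [Milnor1963]
* A. Kas, *On the handlebody decomposition associated to a Lefschetz fibration*, Pacific J.
  Math. 89 (1980), 89–104. [Kas1980]
-/

open scoped Manifold ContDiff Topology
open Set Function Filter

noncomputable section

namespace Literature.Topology.FourManifolds

universe u

/-! ### §1 The Hessian of `φ ∘ f` at an interior critical point -/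

section RealComp

variable {E H : Type*} [NormedAddCommGroup E] [NormedSpace ℝ E] [TopologicalSpace H]
  {I : ModelWithCorners ℝ E H} {M : Type*} [TopologicalSpace M] [ChartedSpace H M]

/-- Post-composition read in the preferred extended chart. [folklore] -/
theorem writtenInExtChartAt_real_comp (f : M → ℝ) (φ : ℝ → ℝ) (x : M) :
    writtenInExtChartAt I 𝓘(ℝ, ℝ) x (fun y => φ (f y)) = φ ∘ writtenInExtChartAt I 𝓘(ℝ, ℝ) x f := by
  ext z
  simp [writtenInExtChartAt]

/-- **The Hessian of `φ ∘ f` at an interior critical point of `f` is `φ'(f x) · Hess f`**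
(second-order chain rule: the term `φ''(f x) df ⊗ df` vanishes at a critical point; Milnor,
*Morse theory* (1963), §2, the Hessian in local coordinates). [cite: Milnor1963, §2] -/
theorem mhessian_real_comp_of_isMCriticalPt {f : M → ℝ} {φ : ℝ → ℝ} {x : M}
    (hx : I.IsInteriorPoint x) (hf : ContMDiffAt I 𝓘(ℝ, ℝ) 2 f x) (hφ : ContDiffAt ℝ 2 φ (f x))
    (hcrit : IsMCriticalPt I f x) :
    mhessian I (fun y => φ (f y)) x = deriv φ (f x) • mhessian I f x := by
  set g := writtenInExtChartAt I 𝓘(ℝ, ℝ) x f with hg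
  set z₀ := extChartAt I x x with hz₀
  have hrange : range I ∈ 𝓝 z₀ := range_mem_nhds_isInteriorPoint hx
  have hgc : ContDiffAt ℝ 2 g z₀ := (contMDiffAt_iff.1 hf).2.contDiffAt hrange
  have hgz₀ : g z₀ = f x := by
    simp [hg, hz₀, writtenInExtChartAt]
  have hmd : MDifferentiableAt I 𝓘(ℝ, ℝ) f x := hf.mdifferentiableAt (by norm_cast)
  have hcrit' : fderiv ℝ g z₀ = 0 := by
    have h := hmd.mfderiv
    rw [show mfderiv I 𝓘(ℝ, ℝ) f x = 0 from hcrit, fderivWithin_of_mem_nhds hrange] at h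
    exact h.symm
  -- `φ` is differentiable near `f x`, `g` near `z₀`
  have hφd : ∀ᶠ t in 𝓝 (f x), DifferentiableAt ℝ φ t := by
    filter_upwards [hφ.eventually (by simp)] with t ht
    exact ht.differentiableAt (by norm_cast)
  have hgd : ∀ᶠ z in 𝓝 z₀, DifferentiableAt ℝ g z := by
    filter_upwards [hgc.eventually (by simp)] with z hz
    exact hz.differentiableAt (by norm_cast)
  have hφd' : ∀ᶠ z in 𝓝 z₀, DifferentiableAt ℝ φ (g z) := by
    have h := hgc.continuousAt.eventually (hgz₀ ▸ hφd : ∀ᶠ t in 𝓝 (g z₀), DifferentiableAt ℝ φ t)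
    exact h
  -- first derivative of the composite near `z₀`
  have h1 : fderiv ℝ (φ ∘ g) =ᶠ[𝓝 z₀] fun z => deriv φ (g z) • fderiv ℝ g z := by
    filter_upwards [hgd, hφd'] with z hz1 hz2
    have h := (hz2.hasDerivAt.hasFDerivAt.comp z hz1.hasFDerivAt).fderiv
    rw [h]
    ext v
    simp [mul_comm]
  -- second derivative at `z₀`
  have hφ2 : DifferentiableAt ℝ (deriv φ) (g z₀) := by
    rw [hgz₀]
    have h1 : DifferentiableAt ℝ (fderiv ℝ φ) (f x) :=
      (hφ.fderiv_right (m := 1) (by norm_num)).differentiableAt (by norm_num)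
    have h2 : deriv φ = fun t => fderiv ℝ φ t 1 := by
      funext t
      rfl
    rw [h2]
    exact h1.clm_apply (differentiableAt_const _)
  have hcd : DifferentiableAt ℝ (fun z => deriv φ (g z)) z₀ := hφ2.comp z₀ hgd.self_of_nhds
  have hud : HasFDerivAt (fderiv ℝ g) (fderiv ℝ (fderiv ℝ g) z₀) z₀ :=
    ((hgc.fderiv_right (m := 1) (by norm_num)).differentiableAt (by norm_num)).hasFDerivAt
  have h3 : HasFDerivAt (fun z => deriv φ (g z) • fderiv ℝ g z)
      (deriv φ (g z₀) • fderiv ℝ (fderiv ℝ g) z₀ +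
        (fderiv ℝ (fun z => deriv φ (g z)) z₀).smulRight (fderiv ℝ g z₀)) z₀ :=
    hcd.hasFDerivAt.smul hud
  have h2 : fderiv ℝ (fderiv ℝ (φ ∘ g)) z₀ = deriv φ (g z₀) • fderiv ℝ (fderiv ℝ g) z₀ := by
    rw [h1.fderiv_eq, h3.fderiv, hcrit']
    ext u v
    simp
  ext u v
  simp only [LinearMap.smul_apply, smul_eq_mul]
  rw [mhessian_apply_eq_fderiv_fderiv_of_isInteriorPoint hx,
    mhessian_apply_eq_fderiv_fderiv_of_isInteriorPoint hx, writtenInExtChartAt_real_comp]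
  change fderiv ℝ (fderiv ℝ (φ ∘ g)) z₀ u v = deriv φ (f x) * fderiv ℝ (fderiv ℝ g) z₀ u v
  rw [h2, hgz₀]
  rfl

/-- **Nondegeneracy of `φ ∘ f` at an interior critical point**, `φ' ≠ 0` there.
[cite: Milnor1963, §2] -/
theorem nondegenerate_mhessian_real_comp_iff {f : M → ℝ} {φ : ℝ → ℝ} {x : M}
    (hx : I.IsInteriorPoint x) (hf : ContMDiffAt I 𝓘(ℝ, ℝ) 2 f x) (hφ : ContDiffAt ℝ 2 φ (f x))
    (hcrit : IsMCriticalPt I f x) (hφ' : deriv φ (f x) ≠ 0) :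
    (mhessian I (fun y => φ (f y)) x).Nondegenerate ↔ (mhessian I f x).Nondegenerate := by
  rw [mhessian_real_comp_of_isMCriticalPt hx hf hφ hcrit]
  exact LinearMap.BilinForm.nondegenerate_smul_iff _ hφ'

/-- **The Morse index of `φ ∘ f` at an interior critical point**, `φ' > 0` there, is that of
`f` (a positive rescaling of the Hessian, `sigNeg_smul`). [cite: Milnor1963, §2] -/
theorem morseIndex_real_comp_eq [FiniteDimensional ℝ E] {f : M → ℝ} {φ : ℝ → ℝ} {x : M}
    (hx : I.IsInteriorPoint x) (hf : ContMDiffAt I 𝓘(ℝ, ℝ) 2 f x) (hφ : ContDiffAt ℝ 2 φ (f x))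
    (hcrit : IsMCriticalPt I f x) (hφ' : 0 < deriv φ (f x)) :
    morseIndex I (fun y => φ (f y)) x = morseIndex I f x := by
  unfold morseIndex
  rw [mhessian_real_comp_of_isMCriticalPt hx hf hφ hcrit]
  have h : (deriv φ (f x) • mhessian I f x).toQuadraticMap =
      deriv φ (f x) • (mhessian I f x).toQuadraticMap := by
    ext v; simp
  rw [h, sigNeg_smul hφ']

end RealComp

/-! ### §2 Inward vectors and functions maximal on the boundary -/

section Inward

variable {n : ℕ} {W : Type u} [TopologicalSpace W] [ChartedSpace (EuclideanHalfSpace (n + 1)) W]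
  [IsManifold (𝓡∂ (n + 1)) ∞ W]

/-- **A function maximal and regular at a boundary point strictly decreases along inward
vectors there.**  If `f ≤ f x` everywhere, `x ∈ ∂W`, `f` is differentiable and not critical at
`x`, and `v ∈ T_x W` points strictly inward (`v₀ > 0` in the boundary chart), then
`df_x(v) < 0`: read in the chart at `x`, `f` has a local maximum on the half-space at a point of
the boundary hyperplane, so `df_x(w) ≤ 0` for every weakly inward `w`
(`IsLocalMaxOn.hasFDerivWithinAt_nonpos`); if moreover `df_x(v) = 0` for a strictly inward
`v`, then `df_x(u) = df_x(u + c v) ≤ 0` for all `u` (take `c` large), forcing `df_x = 0`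
(Milnor 1965, proof of Lemma 2.6 / Thm. 3.4: inward fields versus boundary-defining
functions). [cite: MilnorHCobordism1965, Lemma 2.6] -/
theorem mlineDeriv_neg_of_forall_le_of_mem_boundary {f : W → ℝ} {x : W}
    (hf : MDifferentiableAt (𝓡∂ (n + 1)) 𝓘(ℝ, ℝ) f x) (hle : ∀ y, f y ≤ f x)
    (hx : x ∈ (𝓡∂ (n + 1)).boundary W) (hcrit : ¬ IsMCriticalPt (𝓡∂ (n + 1)) f x)
    {v : TangentSpace (𝓡∂ (n + 1)) x} (hv : 0 < halfSpaceCoord n v) :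
    mlineDeriv (𝓡∂ (n + 1)) f x v < 0 := by
  set g := writtenInExtChartAt (𝓡∂ (n + 1)) 𝓘(ℝ, ℝ) x f with hg
  set z₀ := extChartAt (𝓡∂ (n + 1)) x x with hz₀
  set L : EuclideanSpace ℝ (Fin (n + 1)) →L[ℝ] ℝ := mfderiv (𝓡∂ (n + 1)) 𝓘(ℝ, ℝ) f x with hL
  set v' : EuclideanSpace ℝ (Fin (n + 1)) := v with hv'
  have hLw : HasFDerivWithinAt g L (range (𝓡∂ (n + 1))) z₀ := by
    rw [hL, hf.mfderiv]
    exact hf.differentiableWithinAt_writtenInExtChartAt.hasFDerivWithinAt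
  -- `g` has a local maximum on the half-space at `z₀`
  have hmax : IsLocalMaxOn g (range (𝓡∂ (n + 1))) z₀ := by
    have hmem : (extChartAt (𝓡∂ (n + 1)) x).target ∈ 𝓝[range (𝓡∂ (n + 1))] z₀ :=
      extChartAt_target_mem_nhdsWithin x
    filter_upwards [hmem] with z hz
    have h1 : g z = f ((extChartAt (𝓡∂ (n + 1)) x).symm z) := by simp [hg, writtenInExtChartAt]
    have h2 : g z₀ = f x := by simp [hg, hz₀, writtenInExtChartAt]
    rw [h1, h2]
    exact hle _
  have hz₀0 : z₀ 0 = 0 := extChartAt_apply_zero_of_mem_boundary (mem_extChartAt_source x) hx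
  -- weakly inward vectors lie in the positive tangent cone of the half-space at `z₀`
  have hcone : ∀ w : EuclideanSpace ℝ (Fin (n + 1)), 0 ≤ w 0 →
      w ∈ posTangentConeAt (range (𝓡∂ (n + 1))) z₀ := by
    intro w hw
    apply mem_posTangentConeAt_of_segment_subset
    rw [range_modelWithCornersEuclideanHalfSpace]
    intro y hy
    obtain ⟨a, b, ha, hb, hab, rfl⟩ := hy
    show (0 : ℝ) ≤ (a • z₀ + b • (z₀ + w)) 0
    simp only [PiLp.add_apply, PiLp.smul_apply, smul_eq_mul, hz₀0, mul_zero, zero_add]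
    exact mul_nonneg hb hw
  have hnonpos : ∀ w : EuclideanSpace ℝ (Fin (n + 1)), 0 ≤ w 0 → L w ≤ 0 := fun w hw =>
    hmax.hasFDerivWithinAt_nonpos hLw (hcone w hw)
  -- strictness
  have hv0 : 0 < v' 0 := hv
  have hLv : L v' ≤ 0 := hnonpos v' hv0.le
  have hgoal : mlineDeriv (𝓡∂ (n + 1)) f x v = L v' := rfl
  rw [hgoal]
  rcases hLv.lt_or_eq with hlt | heq
  · exact hlt
  · exfalso
    apply hcrit
    have key : ∀ u : EuclideanSpace ℝ (Fin (n + 1)), L u ≤ 0 := by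
      intro u
      set c : ℝ := |u 0| / v' 0 + 1 with hc
      have h1 : 0 ≤ (u + c • v') 0 := by
        simp only [PiLp.add_apply, PiLp.smul_apply, smul_eq_mul, hc]
        rw [add_mul, div_mul_cancel₀ _ hv0.ne', one_mul]
        nlinarith [neg_abs_le (u 0), abs_nonneg (u 0)]
      have h2 := hnonpos _ h1
      rw [map_add, map_smul, heq, smul_zero, add_zero] at h2
      exact h2
    have hL0 : L = 0 := by
      ext u
      have h1 := key u
      have h2 := key (-u)
      rw [map_neg] at h2
      have : L u = 0 := le_antisymm h1 (by linarith)
      simpa using this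
    exact hL0

end Inward

/-! ### §3 The derivative of a cut-off combination along a vector -/

section Combination

variable {E H : Type*} [NormedAddCommGroup E] [NormedSpace ℝ E] [TopologicalSpace H]
  {I : ModelWithCorners ℝ E H} {M : Type*} [TopologicalSpace M] [ChartedSpace H M]

/-- `Z(A · B + (1 - A) · C) = Z(A) (B - C) + A Z(B) + (1 - A) Z(C)`. [folklore] -/
theorem mlineDeriv_cutoffCombination {A B C : M → ℝ} {z : M}
    (hA : MDifferentiableAt I 𝓘(ℝ, ℝ) A z) (hB : MDifferentiableAt I 𝓘(ℝ, ℝ) B z)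
    (hC : MDifferentiableAt I 𝓘(ℝ, ℝ) C z) (v : TangentSpace I z) :
    mlineDeriv I (fun y => A y * B y + (1 - A y) * C y) z v =
      mlineDeriv I A z v * (B z - C z) + A z * mlineDeriv I B z v +
        (1 - A z) * mlineDeriv I C z v := by
  have HA := hA.hasMFDerivAt
  have HB := hB.hasMFDerivAt
  have HC := hC.hasMFDerivAt
  have H := (HA.mul HB).add (HC.sub (HA.mul HC))
  have hfun : (fun y => A y * B y + (1 - A y) * C y) = A * B + (C - A * C) := by
    funext y; simp; ring
  rw [mlineDeriv_def, hfun, H.mfderiv, mlineDeriv_def, mlineDeriv_def, mlineDeriv_def]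
  change A z * (show ℝ from mfderiv I 𝓘(ℝ, ℝ) B z v) +
        B z * (show ℝ from mfderiv I 𝓘(ℝ, ℝ) A z v) +
      ((show ℝ from mfderiv I 𝓘(ℝ, ℝ) C z v) -
        (A z * (show ℝ from mfderiv I 𝓘(ℝ, ℝ) C z v) +
          C z * (show ℝ from mfderiv I 𝓘(ℝ, ℝ) A z v))) = _
  ring

end Combination

/-! ### §4 The gluing -/

section Gluing

variable {n : ℕ} {W : Type u} [TopologicalSpace W] [T2Space W]
  [ChartedSpace (EuclideanHalfSpace (n + 1)) W] [IsManifold (𝓡∂ (n + 1)) ∞ W] [CompactSpace W]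

/-- A convex combination of two numbers `< 1` is `< 1`. [folklore] -/
theorem cutoff_combination_lt_one {c a b : ℝ} (hc0 : 0 ≤ c) (hc1 : c ≤ 1) (ha : a < 1) (hb : b < 1) :
    c * a + (1 - c) * b < 1 := by
  rcases hc0.lt_or_eq with hc | rfl
  · nlinarith [mul_nonneg (sub_nonneg.2 hc1) (sub_nonneg.2 hb.le)]
  · linarith

/-- **A Morse function adapted to the boundary from interior Morse data and an inward field**
(the module docstring displays the construction `F = χ(f₀) f₀ + (1 - χ(f₀)) κ(G)` and its
verification).  Hypotheses: `W` compact with boundary; `G` smooth at the interior points; `Z` a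
smooth vector field, strictly inward on `∂W`; `K ⊆ Int W` compact with `Z(G) < 0` at the
interior points off `K` and nondegenerate critical points of `G` on `K`.  Conclusion: a Morse
function `F` adapted to `∂W` (`IsMorseAdapted`) whose critical points are exactly the critical
points of `G` in `K`, with the same Morse indices (Milnor 1965, Lemma 2.6, Def. 3.1, and the
cut-off gluing of the proofs of Thm. 2.7 / Lemma 3.7). [cite: MilnorHCobordism1965, Lemma 2.6, Def. 3.1, Lemma 3.7] -/
theorem exists_isMorseAdapted_of_interior
    {G : W → ℝ} (hG : ∀ x, (𝓡∂ (n + 1)).IsInteriorPoint x → ContMDiffAt (𝓡∂ (n + 1)) 𝓘(ℝ, ℝ) ∞ G x)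
    {Z : Π x : W, TangentSpace (𝓡∂ (n + 1)) x}
    (hZ : ContMDiff (𝓡∂ (n + 1)) (𝓡∂ (n + 1)).tangent ∞
      fun x => (⟨x, Z x⟩ : TangentBundle (𝓡∂ (n + 1)) W))
    (hZin : ∀ x ∈ (𝓡∂ (n + 1)).boundary W, 0 < halfSpaceCoord n (Z x))
    {K : Set W} (hK : IsCompact K) (hKint : K ⊆ (𝓡∂ (n + 1)).interior W)
    (hGZ : ∀ x ∈ (𝓡∂ (n + 1)).interior W, x ∉ K → mlineDeriv (𝓡∂ (n + 1)) G x (Z x) < 0)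
    (hGnd : ∀ x ∈ K, IsMCriticalPt (𝓡∂ (n + 1)) G x →
      (mhessian (𝓡∂ (n + 1)) G x).Nondegenerate) :
    ∃ F : W → ℝ, IsMorseAdapted (𝓡∂ (n + 1)) F ∧
      (∀ x, IsMCriticalPt (𝓡∂ (n + 1)) F x ↔ x ∈ K ∧ IsMCriticalPt (𝓡∂ (n + 1)) G x) ∧
      ∀ x ∈ K, IsMCriticalPt (𝓡∂ (n + 1)) G x →
        morseIndex (𝓡∂ (n + 1)) F x = morseIndex (𝓡∂ (n + 1)) G x := by
  -- ### Milnor's boundary-defining function `f₀`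
  obtain ⟨f₀, hf₀s, hf₀b, hf₀i⟩ := exists_contMDiff_eq_one_on_boundary (n := n) (M := W)
  have hf₀le : ∀ y, f₀ y ≤ 1 := fun y => by
    rcases (𝓡∂ (n + 1)).isInteriorPoint_or_isBoundaryPoint y with h | h
    · exact (hf₀i y h).le
    · exact (hf₀b y h).1.le
  have hf₀d : ∀ y, MDifferentiableAt (𝓡∂ (n + 1)) 𝓘(ℝ, ℝ) f₀ y := fun y =>
    (hf₀s y).mdifferentiableAt (by simp)
  -- ### `Z(f₀)`: continuous, negative on the boundary
  set φ₀ : W → ℝ := fun y => mlineDeriv (𝓡∂ (n + 1)) f₀ y (Z y) with hφ₀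
  have hφ₀c : Continuous φ₀ := (contMDiff_mlineDeriv_section hf₀s hZ).continuous
  have hφ₀b : ∀ y ∈ (𝓡∂ (n + 1)).boundary W, φ₀ y < 0 := by
    intro y hy
    have hy' : (𝓡∂ (n + 1)).IsBoundaryPoint y := hy
    have h1 : f₀ y = 1 := (hf₀b y hy').1
    exact mlineDeriv_neg_of_forall_le_of_mem_boundary (hf₀d y)
      (fun w => by rw [h1]; exact hf₀le w) hy (hf₀b y hy').2 (hZin y hy)
  -- ### the compact set `S = {Z(f₀) ≥ 0} ∪ K` of interior points, and `ε`
  set S : Set W := {y | 0 ≤ φ₀ y} ∪ K with hS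
  have hSc : IsCompact S := (isClosed_le continuous_const hφ₀c).isCompact.union hK
  have hSlt : ∀ y ∈ S, f₀ y < 1 := by
    intro y hy
    apply hf₀i
    rcases hy with hy | hy
    · by_contra hint
      have hb : y ∈ (𝓡∂ (n + 1)).boundary W :=
        ((𝓡∂ (n + 1)).isBoundaryPoint_iff_not_isInteriorPoint y).2 hint
      exact absurd hy (not_le.2 (hφ₀b y hb))
    · exact hKint hy
  obtain ⟨ε, hε, hε4, hSε⟩ : ∃ ε : ℝ, 0 < ε ∧ 4 * ε ≤ 1 ∧ ∀ y ∈ S, f₀ y ≤ 1 - 3 * ε := by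
    by_cases hne : S.Nonempty
    · obtain ⟨y₀, hy₀, hmax⟩ := hSc.exists_isMaxOn hne hf₀s.continuous.continuousOn
      have h1 : f₀ y₀ < 1 := hSlt y₀ hy₀
      refine ⟨min (1 / 4) ((1 - f₀ y₀) / 3), lt_min (by norm_num) (by linarith), ?_,
        fun y hy => ?_⟩
      · linarith [min_le_left (1 / 4 : ℝ) ((1 - f₀ y₀) / 3)]
      · have h2 : f₀ y ≤ f₀ y₀ := hmax hy
        linarith [min_le_right (1 / 4 : ℝ) ((1 - f₀ y₀) / 3)]
    · exact ⟨1 / 4, by norm_num, by norm_num, fun y hy => (hne ⟨y, hy⟩).elim⟩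
  have hoff : ∀ y, 1 - 3 * ε < f₀ y → φ₀ y < 0 ∧ y ∉ K := by
    intro y hy
    have hyS : y ∉ S := fun h => absurd (hSε y h) (not_le.2 hy)
    exact ⟨not_le.1 fun h => hyS (Or.inl h), fun h => hyS (Or.inr h)⟩
  -- ### the cut-off `χ` and the squashing `κ`
  set χ : ℝ → ℝ := fun t => Real.smoothTransition ((t - (1 - 2 * ε)) / ε) with hχ
  have hχs : ContDiff ℝ ∞ χ :=
    Real.smoothTransition.contDiff.comp ((contDiff_id.sub contDiff_const).div_const _)
  have hχm : Monotone χ := fun a b hab =>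
    Real.smoothTransition.monotone (div_le_div_of_nonneg_right (by linarith) hε.le)
  have hχ0 : ∀ t, t ≤ 1 - 2 * ε → χ t = 0 := fun t ht =>
    Real.smoothTransition.zero_of_nonpos (div_nonpos_of_nonpos_of_nonneg (by linarith) hε.le)
  have hχ1 : ∀ t, 1 - ε ≤ t → χ t = 1 := fun t ht =>
    Real.smoothTransition.one_of_one_le ((one_le_div hε).2 (by linarith))
  have hχnn : ∀ t, 0 ≤ χ t := fun t => Real.smoothTransition.nonneg _
  have hχle : ∀ t, χ t ≤ 1 := fun t => Real.smoothTransition.le_one _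
  have hχ' : ∀ t, 0 ≤ deriv χ t := fun t => hχm.deriv_nonneg
  have hχd : ∀ t, HasDerivAt χ (deriv χ t) t := fun t =>
    (hχs.differentiable (by simp) t).hasDerivAt
  set κ : ℝ → ℝ := fun s => 1 - 3 * ε - Real.exp (-s) with hκ
  have hκs : ContDiff ℝ ∞ κ := contDiff_const.sub (Real.contDiff_exp.comp contDiff_neg)
  have hκlt : ∀ s, κ s < 1 - 3 * ε := fun s => by
    have := Real.exp_pos (-s)
    simp only [hκ]
    linarith
  have hκd : ∀ s, HasDerivAt κ (Real.exp (-s)) s := fun s => by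
    have h := ((Real.hasDerivAt_exp (-s)).comp s (hasDerivAt_neg s)).const_sub (1 - 3 * ε)
    have h' : -(Real.exp (-s) * -1) = Real.exp (-s) := by ring
    rw [h'] at h
    exact h
  have hκ' : ∀ s, deriv κ s = Real.exp (-s) := fun s => (hκd s).deriv
  have hκ'pos : ∀ s, 0 < deriv κ s := fun s => by rw [hκ']; exact Real.exp_pos _
  -- ### the function `F`
  set F : W → ℝ := fun y => χ (f₀ y) * f₀ y + (1 - χ (f₀ y)) * κ (G y) with hF
  -- near the boundary `F = f₀`
  have hFtop : ∀ y, 1 - ε < f₀ y → F =ᶠ[𝓝 y] f₀ := by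
    intro y hy
    have hopen : IsOpen {y' | 1 - ε < f₀ y'} := isOpen_lt continuous_const hf₀s.continuous
    filter_upwards [hopen.mem_nhds hy] with y' hy'
    simp only [hF, hχ1 _ (le_of_lt hy'), one_mul, sub_self, zero_mul, add_zero]
  -- deep inside `F = κ ∘ G`
  have hFdeep : ∀ y, f₀ y < 1 - 2 * ε → F =ᶠ[𝓝 y] fun y' => κ (G y') := by
    intro y hy
    have hopen : IsOpen {y' | f₀ y' < 1 - 2 * ε} := isOpen_lt hf₀s.continuous continuous_const
    filter_upwards [hopen.mem_nhds hy] with y' hy'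
    simp only [hF, hχ0 _ (le_of_lt hy'), zero_mul, sub_zero, one_mul, zero_add]
  -- ### smoothness
  have hGd : ∀ y, (𝓡∂ (n + 1)).IsInteriorPoint y →
      MDifferentiableAt (𝓡∂ (n + 1)) 𝓘(ℝ, ℝ) G y :=
    fun y hy => (hG y hy).mdifferentiableAt (by simp)
  have hFs_int : ∀ y, (𝓡∂ (n + 1)).IsInteriorPoint y →
      ContMDiffAt (𝓡∂ (n + 1)) 𝓘(ℝ, ℝ) ∞ F y := by
    intro y hy
    have h1 : ContMDiffAt (𝓡∂ (n + 1)) 𝓘(ℝ, ℝ) ∞ (fun y' => χ (f₀ y')) y :=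
      hχs.contDiffAt.comp_contMDiffAt (hf₀s y)
    have h2 : ContMDiffAt (𝓡∂ (n + 1)) 𝓘(ℝ, ℝ) ∞ (fun y' => κ (G y')) y :=
      hκs.contDiffAt.comp_contMDiffAt (hG y hy)
    exact (h1.mul (hf₀s y)).add ((contMDiffAt_const.sub h1).mul h2)
  have hFs : ContMDiff (𝓡∂ (n + 1)) 𝓘(ℝ, ℝ) ∞ F := by
    intro y
    rcases (𝓡∂ (n + 1)).isInteriorPoint_or_isBoundaryPoint y with hy | hy
    · exact hFs_int y hy
    · have h1 : f₀ y = 1 := (hf₀b y hy).1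
      exact (hf₀s y).congr_of_eventuallyEq (hFtop y (by rw [h1]; linarith))
  -- ### boundary behaviour
  have hFbd : ∀ y ∈ (𝓡∂ (n + 1)).boundary W, F y = 1 ∧ ¬ IsMCriticalPt (𝓡∂ (n + 1)) F y := by
    intro y hy
    have hy' : (𝓡∂ (n + 1)).IsBoundaryPoint y := hy
    have h1 : f₀ y = 1 := (hf₀b y hy').1
    have hev := hFtop y (by rw [h1]; linarith)
    refine ⟨by rw [hev.self_of_nhds, h1], ?_⟩
    rw [isMCriticalPt_congr_of_eventuallyEq hev]
    exact (hf₀b y hy').2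
  -- ### interior values `< 1`
  have hFint : ∀ y ∈ (𝓡∂ (n + 1)).interior W, F y < 1 := by
    intro y hy
    have hy' : (𝓡∂ (n + 1)).IsInteriorPoint y := hy
    have h1 : f₀ y < 1 := hf₀i y hy'
    have h2 : κ (G y) < 1 := by linarith [hκlt (G y)]
    exact cutoff_combination_lt_one (hχnn _) (hχle _) h1 h2
  -- ### no critical points in the collar `{1 - 2ε ≤ f₀}` (interior points)
  have hcollar : ∀ y, (𝓡∂ (n + 1)).IsInteriorPoint y → 1 - 2 * ε ≤ f₀ y →
      ¬ IsMCriticalPt (𝓡∂ (n + 1)) F y := by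
    intro y hy hfy hcrit
    obtain ⟨hφy, hyK⟩ := hoff y (by linarith)
    have hGZy : mlineDeriv (𝓡∂ (n + 1)) G y (Z y) < 0 := hGZ y hy hyK
    have hA : MDifferentiableAt (𝓡∂ (n + 1)) 𝓘(ℝ, ℝ) (fun y' => χ (f₀ y')) y :=
      (hχs.contDiffAt.comp_contMDiffAt (hf₀s y)).mdifferentiableAt (by simp)
    have hC : MDifferentiableAt (𝓡∂ (n + 1)) 𝓘(ℝ, ℝ) (fun y' => κ (G y')) y :=
      (hκs.contDiffAt.comp_contMDiffAt (hG y hy)).mdifferentiableAt (by simp)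
    have hder := mlineDeriv_cutoffCombination (I := 𝓡∂ (n + 1)) hA (hf₀d y) hC (Z y)
    have hA' : mlineDeriv (𝓡∂ (n + 1)) (fun y' => χ (f₀ y')) y (Z y) = deriv χ (f₀ y) * φ₀ y :=
      mlineDeriv_real_comp (hχd _) (hf₀d y) (Z y)
    have hC' : mlineDeriv (𝓡∂ (n + 1)) (fun y' => κ (G y')) y (Z y) =
        Real.exp (-G y) * mlineDeriv (𝓡∂ (n + 1)) G y (Z y) :=
      mlineDeriv_real_comp (hκd _) (hGd y hy) (Z y)
    have hzero : mlineDeriv (𝓡∂ (n + 1)) F y (Z y) = 0 := hcrit.mlineDeriv_eq_zero (Z y)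
    have hFfun : F = fun y' => χ (f₀ y') * f₀ y' + (1 - χ (f₀ y')) * κ (G y') := rfl
    rw [hFfun, hder, hA', hC'] at hzero
    have hgap : 0 < f₀ y - κ (G y) := by linarith [hκlt (G y)]
    have hexp : 0 < Real.exp (-G y) := Real.exp_pos _
    have t1 : deriv χ (f₀ y) * φ₀ y * (f₀ y - κ (G y)) ≤ 0 :=
      mul_nonpos_of_nonpos_of_nonneg (mul_nonpos_of_nonneg_of_nonpos (hχ' _) hφy.le) hgap.le
    have t3 : (1 - χ (f₀ y)) * (Real.exp (-G y) * mlineDeriv (𝓡∂ (n + 1)) G y (Z y)) ≤ 0 :=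
      mul_nonpos_of_nonneg_of_nonpos (sub_nonneg.2 (hχle _))
        (mul_neg_of_pos_of_neg hexp hGZy).le
    rcases (hχnn (f₀ y)).lt_or_eq with hpos | hzeroχ
    · have t2' : χ (f₀ y) * φ₀ y < 0 := mul_neg_of_pos_of_neg hpos hφy
      linarith
    · have t3' : (1 - χ (f₀ y)) * (Real.exp (-G y) * mlineDeriv (𝓡∂ (n + 1)) G y (Z y)) < 0 := by
        rw [← hzeroχ, sub_zero, one_mul]
        exact mul_neg_of_pos_of_neg hexp hGZy
      have t2 : χ (f₀ y) * φ₀ y ≤ 0 := mul_nonpos_of_nonneg_of_nonpos (hχnn _) hφy.le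
      linarith
  -- ### deep interior points: `F = κ ∘ G` near `y`
  have hdeep_crit : ∀ y, (𝓡∂ (n + 1)).IsInteriorPoint y → f₀ y < 1 - 2 * ε →
      (IsMCriticalPt (𝓡∂ (n + 1)) F y ↔ IsMCriticalPt (𝓡∂ (n + 1)) G y) := by
    intro y hy hfy
    rw [isMCriticalPt_congr_of_eventuallyEq (hFdeep y hfy)]
    exact isMCriticalPt_comp_iff_of_hasDerivAt (σ := κ) (hκd (G y)) (Real.exp_pos _).ne'
      (hGd y hy)
  have hdeep_hess : ∀ y, (𝓡∂ (n + 1)).IsInteriorPoint y → f₀ y < 1 - 2 * ε →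
      IsMCriticalPt (𝓡∂ (n + 1)) G y →
      mhessian (𝓡∂ (n + 1)) F y = deriv κ (G y) • mhessian (𝓡∂ (n + 1)) G y := by
    intro y hy hfy hcrit
    have hev : F =ᶠ[𝓝 y] fun y' => κ (G y') + (0 : ℝ) :=
      (hFdeep y hfy).trans (Eventually.of_forall fun y' => (add_zero (κ (G y'))).symm)
    rw [mhessian_congr_of_eventuallyEq_add_const hev]
    exact mhessian_real_comp_of_isMCriticalPt hy ((hG y hy).of_le (by norm_cast))
      (hκs.contDiffAt.of_le (by norm_cast)) hcrit
  -- ### the critical points of `F`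
  have hcritF : ∀ y, IsMCriticalPt (𝓡∂ (n + 1)) F y ↔
      y ∈ K ∧ IsMCriticalPt (𝓡∂ (n + 1)) G y := by
    intro y
    rcases (𝓡∂ (n + 1)).isInteriorPoint_or_isBoundaryPoint y with hy | hy
    · by_cases hfy : f₀ y < 1 - 2 * ε
      · rw [hdeep_crit y hy hfy]
        refine ⟨fun h => ⟨?_, h⟩, fun h => h.2⟩
        by_contra hyK
        exact absurd (h.mlineDeriv_eq_zero (Z y)) (hGZ y hy hyK).ne
      · have h1 := hcollar y hy (not_lt.1 hfy)
        have h2 : y ∉ K := (hoff y (by linarith [not_lt.1 hfy])).2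
        exact ⟨fun h => (h1 h).elim, fun h => (h2 h.1).elim⟩
    · have h1 := (hFbd y hy).2
      have h2 : y ∉ K := fun h =>
        ((𝓡∂ (n + 1)).isBoundaryPoint_iff_not_isInteriorPoint y).1 hy (hKint h)
      exact ⟨fun h => (h1 h).elim, fun h => (h2 h.1).elim⟩
  have hKdeep : ∀ y ∈ K, f₀ y < 1 - 2 * ε := fun y hy => by
    have := hSε y (Or.inr hy)
    linarith
  -- ### assembly
  refine ⟨F, ⟨⟨hFs, fun y hy => ?_⟩, hFbd, hFint⟩, hcritF, fun y hyK hcrit => ?_⟩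
  · obtain ⟨hyK, hcritG⟩ := (hcritF y).1 hy
    have hy' : (𝓡∂ (n + 1)).IsInteriorPoint y := hKint hyK
    rw [hdeep_hess y hy' (hKdeep y hyK) hcritG]
    exact (LinearMap.BilinForm.nondegenerate_smul_iff _ (hκ'pos (G y)).ne').2 (hGnd y hyK hcritG)
  · have hy' : (𝓡∂ (n + 1)).IsInteriorPoint y := hKint hyK
    have hfy := hKdeep y hyK
    rw [morseIndex_congr_of_eventuallyEq (hFdeep y hfy)]
    exact morseIndex_real_comp_eq hy' ((hG y hy').of_le (by norm_cast))
      (hκs.contDiffAt.of_le (by norm_cast)) hcrit (hκ'pos (G y))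

omit [T2Space W] [IsManifold (𝓡∂ (n + 1)) ∞ W] [CompactSpace W] in
/-- **The critical points of each index of the glued function.**
[cite: MilnorHCobordism1965, Def. 3.1] -/
theorem criticalSetOfIndex_eq_inter_of_interior {F G : W → ℝ} {K : Set W}
    (hcrit : ∀ x, IsMCriticalPt (𝓡∂ (n + 1)) F x ↔ x ∈ K ∧ IsMCriticalPt (𝓡∂ (n + 1)) G x)
    (hind : ∀ x ∈ K, IsMCriticalPt (𝓡∂ (n + 1)) G x →
      morseIndex (𝓡∂ (n + 1)) F x = morseIndex (𝓡∂ (n + 1)) G x) (k : ℕ) :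
    criticalSetOfIndex (𝓡∂ (n + 1)) F k = K ∩ criticalSetOfIndex (𝓡∂ (n + 1)) G k := by
  ext x
  simp only [mem_criticalSetOfIndex, mem_inter_iff]
  constructor
  · rintro ⟨h1, h2⟩
    obtain ⟨hK, hG⟩ := (hcrit x).1 h1
    exact ⟨hK, hG, by rw [← hind x hK hG, h2]⟩
  · rintro ⟨hK, hG, h2⟩
    exact ⟨(hcrit x).2 ⟨hK, hG⟩, by rw [hind x hK hG, h2]⟩

/-- **Handle decomposition from interior Morse data** (`HasHandleDecomposition`, Milnor 1965,
§3; Kosinski 1993, VII §1): under the hypotheses of `exists_isMorseAdapted_of_interior`, `W`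
has a handle decomposition with `c k` handles of index `k`, `c k` the number of critical points
of `G` of index `k` lying in `K`. [cite: MilnorHCobordism1965, Def. 3.1, §3] -/
theorem hasHandleDecomposition_of_interior
    {G : W → ℝ} (hG : ∀ x, (𝓡∂ (n + 1)).IsInteriorPoint x → ContMDiffAt (𝓡∂ (n + 1)) 𝓘(ℝ, ℝ) ∞ G x)
    {Z : Π x : W, TangentSpace (𝓡∂ (n + 1)) x}
    (hZ : ContMDiff (𝓡∂ (n + 1)) (𝓡∂ (n + 1)).tangent ∞
      fun x => (⟨x, Z x⟩ : TangentBundle (𝓡∂ (n + 1)) W))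
    (hZin : ∀ x ∈ (𝓡∂ (n + 1)).boundary W, 0 < halfSpaceCoord n (Z x))
    {K : Set W} (hK : IsCompact K) (hKint : K ⊆ (𝓡∂ (n + 1)).interior W)
    (hGZ : ∀ x ∈ (𝓡∂ (n + 1)).interior W, x ∉ K → mlineDeriv (𝓡∂ (n + 1)) G x (Z x) < 0)
    (hGnd : ∀ x ∈ K, IsMCriticalPt (𝓡∂ (n + 1)) G x →
      (mhessian (𝓡∂ (n + 1)) G x).Nondegenerate)
    {c : ℕ → ℕ} (hc : ∀ k, (K ∩ criticalSetOfIndex (𝓡∂ (n + 1)) G k).ncard = c k) :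
    HasHandleDecomposition n W c := by
  obtain ⟨F, hF, hcrit, hind⟩ := exists_isMorseAdapted_of_interior hG hZ hZin hK hKint hGZ hGnd
  exact ⟨F, hF, fun k => by rw [criticalSetOfIndex_eq_inter_of_interior hcrit hind k, hc k]⟩

end Gluing

end Literature.Topology.FourManifolds

end
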